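import Summits.BirchSwinnertonDyer.Rank1Residual.GaloisImage.KolyvaginRescaling
import Summits.BirchSwinnertonDyer.Rank1Residual.GaloisImage.KolyvaginLevelStructures
import Summits.BirchSwinnertonDyer.Rank1Residual.GaloisImage.KolyvaginPrimeLocalFreeness
import Literature.NumberTheory.GaloisRepresentations.LocalGlobalCohomologyDualityProofs
import HarnessLib

/-!
# Two ADMISSIBLE Kolyvagin data differ by units on `H¹_ur`, and their Kolyvagin systems are
# isomorphic by rescaling — the consequence of [MR04] Lemma 1.2.3 that makes "∀ datum" no
# stronger than "the canonical datum"
# (cell `b2b-bsdres`, team n1011; row T-HCC-adm, appendix 2; seat p11 gen 4, ON-CALL item)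

HONEST FRAMING (cell `b2b-bsdres`, run/shared/lean/b2b/bsd-rank1-residual/, verbatim in every
file): the goal of the cell is to DELETE the COMBINATION-SHAPED residual classes of the
Birch–Swinnerton-Dyer formula for ALL analytic-rank `≤ 1` elliptic curves over `ℚ` — "full BSD
formula for every rank `≤ 1` curve in class `C`" assembled STRICTLY from published theorems — so
that the rank-`≤ 1` remainder becomes exactly the CONSTRUCTION-SHAPED classes, which are TYPED
(missing-input `Prop`s), NOT attempted. This is not "finishing BSD". Team n1011 (N10 / N11, the
additive block X4 ∧ `p = 3`): research route; TOOL theorems about Kolyvagin data (no definition, no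
named fact, no `sorry`); nothing is booked; no mark / label moved.

## What

n1011-p13's `KolyvaginRescaling.lean` proves that data whose comparison maps differ by integers
`u_𝔮` on ALL of `H¹(K_𝔮, T)` have rescaled / isomorphic Kolyvagin systems, and records what is NOT
there: "the statement that two ADMISSIBLE data do differ by units (it needs the local freeness
`H¹_{/ur}(K_𝔮, T)` free of rank one over `ℤ/p^m`)". This file supplies it.

* `FSComp.exists_int_apply_eq_smul_of_isFreeRankOneZMod` /
  `FSComp.exists_int_apply_eq_smul_of_surjective` — an additive endomorphism of a group free of
  rank one over `ℤ/N` is multiplication by an integer, a unit mod `N` when it is onto.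
* `FSComp.exists_int_fs_eq_smul_of_bijective` — **two data admissible at `𝔮` differ by a unit on
  `H¹_ur(K_𝔮, T)`** when `H¹_ur(K_𝔮, T)` is free of rank one over `ℤ/N`:
  `∃ u w, w·u ≡ 1 (mod N) ∧ ∀ x ∈ H¹_ur, φ'^{fs}_𝔮 x = u · φ^{fs}_𝔮 x` ([MR04] Lemma 1.2.3: both sides
  are free of rank one, so an isomorphism between them is unique up to `R^×`);
  `FSComp.exists_rescaling_of_isAdmissible` — the global choice `u w : 𝒫 → ℤ`.
* `FSComp.isKolyvaginSystem_rescale_of_le_unramified` /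
  `FSComp.exists_kolyvaginSystems_addEquiv_rescale_of_le_unramified` — p13's two rescaling
  theorems with the relation `φ'^{fs} = u · φ^{fs}` asked ONLY ON `H¹_ur(K_𝔮, T)`, under
  `𝓕_𝔮 ≤ H¹_ur(K_𝔮, T)` at `𝔮 ∈ 𝒫` (the finite–singular relation is only ever evaluated at
  `loc_𝔮 κ_d ∈ 𝓕_𝔮`, `CoreRankZero.Level.atLevel_inr_of_not_mem`); proofs follow p13's line by line.
* `FSComp.exists_kolyvaginSystems_addEquiv_of_isAdmissible` — **END**: two admissible data with
  the same `𝒫` and the same transverse conditions, on an `N`-torsion `T` with `H¹_ur(K_𝔮, T)` free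
  of rank one at every `𝔮 ∈ 𝒫`, have ISOMORPHIC groups of Kolyvagin systems `KS(D, 𝓕) ≃+ KS(D', 𝓕)`
  (by `κ_d ↦ (∏_{𝔮∈d} u_𝔮) κ_d`, units `u_𝔮`) for every Selmer structure `𝓕` unramified-or-finer
  at `𝒫`. With `KolyvaginPrimeLocalFreeness.lean` (free `H¹_ur` at Sakamoto's `τ`-class primes)
  and `CanonicalKolyvaginDatumAdmissible*.lean` (the canonical datum is admissible) this is the
  kernel form of "the choice of `φ^{fs}` does not matter" (route (A) of the team's Stage-2b note):
  `FSComp.exists_kolyvaginSystems_addEquiv_of_hasCanonicalComparison_primePow` — over `ℚ`, two data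
  with THE canonical comparison maps for generator choices `η, η'`, the same primes inside
  Sakamoto's `τ`-class and the same transverse conditions, on a free finite `ℤ/p^n`-module, have
  isomorphic `KS(·, 𝓕)` for every `𝓕` unramified-or-finer at `𝒫` — NO admissibility or freeness
  hypothesis left.

References: B. Mazur, K. Rubin, Mem. AMS 799 (2004), Def. 1.2.2, Lemma 1.2.3 (pp. 10–11);
K. Rubin, PCMI 18 (2011), Ex. 1.9.7, Def. 2.2.1; R. Sakamoto, JTNB 36 (2024) Def. 4.1, Rem. 4.3
(p. 926).
-/

noncomputable section

open scoped Classical NumberField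
open Field NumberField IsDedekindDomain
open Literature.NumberTheory.GaloisRepresentations Literature.NumberTheory.GaloisRepresentations.DiscreteGaloisModule
  Literature.NumberTheory.GaloisCohomology

namespace Summit.BirchSwinnertonDyer.Rank1Residual.GaloisImage.FSComp

/-! ### §1 Endomorphisms of a group free of rank one over `ℤ/N` -/

section Algebra

/-- **An additive endomorphism of a group free of rank one over `ℤ/N` is multiplication by an
integer** (`β(z) = z · β(1)` on `ℤ/N`). [folklore] -/
theorem exists_int_apply_eq_smul_of_isFreeRankOneZMod {X : Type*} [AddCommGroup X] {N : ℕ}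
    [NeZero N] (h : KolyvaginSystem.IsFreeRankOneZMod X N) (β : X →+ X) :
    ∃ u : ℤ, ∀ x, β x = u • x := by
  obtain ⟨e⟩ := h
  let β' : ZMod N →+ ZMod N := (e.toAddMonoidHom.comp β).comp e.symm.toAddMonoidHom
  have h1 : ∀ x, β' (e x) = e (β x) := fun x => by
    simp only [β', AddMonoidHom.coe_comp, Function.comp_apply, AddEquiv.coe_toAddMonoidHom,
      AddEquiv.symm_apply_apply]
  have hβ' : ∀ z : ZMod N, β' z = z * β' 1 := fun z => by
    have hz : z = z.val • (1 : ZMod N) := by rw [nsmul_one, ZMod.natCast_zmod_val]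
    conv_lhs => rw [hz]
    rw [map_nsmul, nsmul_eq_mul, ZMod.natCast_zmod_val]
  have hu : ((((β' 1).val : ℕ) : ℤ) : ZMod N) = β' 1 := by
    rw [Int.cast_natCast, ZMod.natCast_zmod_val]
  refine ⟨((β' 1).val : ℤ), fun x => e.injective ?_⟩
  rw [← h1, hβ', map_zsmul, zsmul_eq_mul, hu, mul_comm]

/-- … and by a UNIT mod `N` (with an explicit inverse `w`) when the endomorphism is onto.
[folklore] -/
theorem exists_int_apply_eq_smul_of_surjective {X : Type*} [AddCommGroup X] {N : ℕ} [NeZero N]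
    (h : KolyvaginSystem.IsFreeRankOneZMod X N) (β : X →+ X) (hβ : Function.Surjective β) :
    ∃ u w : ℤ, ((w * u : ℤ) : ZMod N) = 1 ∧ ∀ x, β x = u • x := by
  obtain ⟨u, hu⟩ := exists_int_apply_eq_smul_of_isFreeRankOneZMod h β
  obtain ⟨e⟩ := h
  obtain ⟨x, hx⟩ := hβ (e.symm 1)
  refine ⟨u, ((e x).val : ℤ), ?_, hu⟩
  have h1 : e (β x) = 1 := by rw [hx, AddEquiv.apply_symm_apply]
  rw [hu, map_zsmul, zsmul_eq_mul] at h1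
  rw [Int.cast_mul, Int.cast_natCast, ZMod.natCast_zmod_val, mul_comm]
  exact h1

/-- `a ≡ 1 (mod N)` acts trivially on `N`-torsion elements. [folklore] -/
theorem zsmul_eq_self_of_intCast_eq_one {A : Type*} [AddCommGroup A] {N : ℕ} {a : ℤ}
    (ha : ((a : ℤ) : ZMod N) = 1) {x : A} (hx : N • x = 0) : a • x = x := by
  have hdvd : (N : ℤ) ∣ a - 1 :=
    (ZMod.intCast_zmod_eq_zero_iff_dvd (a - 1) N).1 (by rw [Int.cast_sub, ha, Int.cast_one, sub_self])
  obtain ⟨k, hk⟩ := hdvd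
  have ha' : a = 1 + k * N := by linarith
  rw [ha', add_smul, one_smul, ← smul_smul, natCast_zsmul, hx, smul_zero, add_zero]

end Algebra

/-! ### §2 Two admissible data differ by units on `H¹_ur(K_𝔮, T)` -/

section Local

universe u

variable {K : Type u} [Field K] [NumberField K] {M : Type u} [AddCommGroup M] [TopologicalSpace M]
  [DiscreteTopology M] {ρ : DiscreteGaloisModule K M}

/-- **Two comparison maps admissible at `𝔮` differ by a unit on `H¹_ur(K_𝔮, T)`** ([MR04] Lemma
1.2.3: with `H¹_ur(K_𝔮, T)` free of rank one over `R = ℤ/N`, so is `H¹_{/ur}(K_𝔮, T)` through either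
admissible map, and `φ'^{fs}_𝔮 ∘ (φ^{fs}_𝔮)⁻¹ ∈ Aut_R(R) = R^×`): there are integers `u, w` with
`w·u ≡ 1 (mod N)` and `φ'^{fs}_𝔮 x = u · φ^{fs}_𝔮 x` for every unramified class `x`.
[cite: MazurRubin2004, Lemma 1.2.3 (p. 10–11)] [cite: Rubin2011, Exercise 1.9.7 (p. 15)] -/
theorem exists_int_fs_eq_smul_of_bijective {D D' : KolyvaginDatum ρ} {q : HeightOneSpectrum (𝓞 K)}
    {N : ℕ} [NeZero N]
    (hD : Function.Bijective fun x : unramifiedSubgroup (GaloisRep.toLocal q ρ) 1 =>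
      D.fs q (x : galoisCohomology _ 1))
    (hD' : Function.Bijective fun x : unramifiedSubgroup (GaloisRep.toLocal q ρ) 1 =>
      D'.fs q (x : galoisCohomology _ 1))
    (hfree : KolyvaginSystem.IsFreeRankOneZMod (unramifiedSubgroup (GaloisRep.toLocal q ρ) 1) N) :
    ∃ u w : ℤ, ((w * u : ℤ) : ZMod N) = 1 ∧
      ∀ x ∈ unramifiedSubgroup (GaloisRep.toLocal q ρ) 1, D'.fs q x = u • D.fs q x := by
  let f₁ : unramifiedSubgroup (GaloisRep.toLocal q ρ) 1 →+ SingularQuotient (GaloisRep.toLocal q ρ) :=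
    AddMonoidHom.mk' (fun x => D.fs q (x : galoisCohomology (GaloisRep.toLocal q ρ) 1))
      fun x y => by rw [AddSubgroup.coe_add, map_add]
  let f₂ : unramifiedSubgroup (GaloisRep.toLocal q ρ) 1 →+ SingularQuotient (GaloisRep.toLocal q ρ) :=
    AddMonoidHom.mk' (fun x => D'.fs q (x : galoisCohomology (GaloisRep.toLocal q ρ) 1))
      fun x y => by rw [AddSubgroup.coe_add, map_add]
  have hf₁ : Function.Bijective f₁ := hD
  have hf₂ : Function.Bijective f₂ := hD'
  let e₁ := AddEquiv.ofBijective f₁ hf₁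
  let e₂ := AddEquiv.ofBijective f₂ hf₂
  obtain ⟨e⟩ := hfree
  have hfreeS : KolyvaginSystem.IsFreeRankOneZMod (SingularQuotient (GaloisRep.toLocal q ρ)) N :=
    ⟨e₁.symm.trans e⟩
  -- `δ := φ'^{fs} ∘ (φ^{fs})⁻¹`, an automorphism of the singular quotient
  let δ : SingularQuotient (GaloisRep.toLocal q ρ) →+ SingularQuotient (GaloisRep.toLocal q ρ) :=
    e₂.toAddMonoidHom.comp e₁.symm.toAddMonoidHom
  have hδ : ∀ y, δ y = e₂ (e₁.symm y) := fun y => rfl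
  have hδs : Function.Surjective δ := fun y =>
    ⟨e₁ (e₂.symm y), by rw [hδ, AddEquiv.symm_apply_apply, AddEquiv.apply_symm_apply]⟩
  obtain ⟨u, w, hwu, hu⟩ := exists_int_apply_eq_smul_of_surjective hfreeS δ hδs
  refine ⟨u, w, hwu, fun x hx => ?_⟩
  have h := hu (e₁ ⟨x, hx⟩)
  rw [hδ, AddEquiv.symm_apply_apply] at h
  exact h

/-- **The global choice of units**: for two ADMISSIBLE data with the same Kolyvagin primes and
`H¹_ur(K_𝔮, T)` free of rank one over `ℤ/N` at every `𝔮 ∈ 𝒫`, there are `u w : 𝒫 → ℤ` (extended by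
`1`) with `w_𝔮 u_𝔮 ≡ 1 (mod N)` and `φ'^{fs}_𝔮 = u_𝔮 · φ^{fs}_𝔮` on `H¹_ur(K_𝔮, T)` for `𝔮 ∈ 𝒫`.
[cite: MazurRubin2004, Lemma 1.2.3 (p. 10–11)] [cite: Sakamoto2024, §4 (p. 925)] -/
theorem exists_rescaling_of_isAdmissible {D D' : KolyvaginDatum ρ} {N : ℕ} [NeZero N]
    (hD : D.IsAdmissible) (hD' : D'.IsAdmissible) (hP : D'.primes = D.primes)
    (hfree : ∀ q ∈ D.primes,
      KolyvaginSystem.IsFreeRankOneZMod (unramifiedSubgroup (GaloisRep.toLocal q ρ) 1) N) :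
    ∃ u w : HeightOneSpectrum (𝓞 K) → ℤ, (∀ q, ((w q * u q : ℤ) : ZMod N) = 1) ∧
      ∀ q ∈ D.primes, ∀ x ∈ unramifiedSubgroup (GaloisRep.toLocal q ρ) 1,
        D'.fs q x = u q • D.fs q x := by
  have key : ∀ q : HeightOneSpectrum (𝓞 K), ∃ uw : ℤ × ℤ, ((uw.2 * uw.1 : ℤ) : ZMod N) = 1 ∧
      (q ∈ D.primes → ∀ x ∈ unramifiedSubgroup (GaloisRep.toLocal q ρ) 1,
        D'.fs q x = uw.1 • D.fs q x) := by
    intro q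
    by_cases hq : q ∈ D.primes
    · have hq' : q ∈ D'.primes := by rw [hP]; exact hq
      obtain ⟨u, w, hwu, hu⟩ := exists_int_fs_eq_smul_of_bijective (hD q hq) (hD' q hq') (hfree q hq)
      exact ⟨(u, w), hwu, fun _ => hu⟩
    · exact ⟨(1, 1), by simp, fun h => absurd h hq⟩
  choose uw huw using key
  exact ⟨fun q => (uw q).1, fun q => (uw q).2, fun q => (huw q).1, fun q hq => (huw q).2 hq⟩

end Local

/-! ### §3 Rescaling with the relation asked only on `H¹_ur` -/

section Rescale

universe u

variable {K : Type u} [Field K] [NumberField K] {M : Type u} [AddCommGroup M] [TopologicalSpace M]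
  [DiscreteTopology M] {ρ : DiscreteGaloisModule K M}

/-- **Rescaling a Kolyvagin system along `φ'^{fs} = u · φ^{fs}` ON `H¹_ur`** (n1011-p13's
`isKolyvaginSystem_rescale` with the relation asked only on unramified classes): if `𝓕_𝔮 ≤ H¹_ur`
at every `𝔮 ∈ 𝒫`, the finite–singular relation is only evaluated at `loc_𝔮 κ_d ∈ 𝓕(d)_𝔮 = 𝓕_𝔮`
(`𝔮 ∉ d`), so the relation on `H¹_ur` suffices. [cite: Sakamoto2024, Def. 4.1 (p. 926) and Rem. 4.3]
[cite: Rubin2011, Def. 2.2.1 (p. 18)] -/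
theorem isKolyvaginSystem_rescale_of_le_unramified {D D' : KolyvaginDatum ρ}
    (u : HeightOneSpectrum (𝓞 K) → ℤ) (hP : D'.primes = D.primes) (hT : D'.transverse = D.transverse)
    {𝓕 : SelmerStructure ρ}
    (h𝓕 : ∀ q ∈ D.primes, 𝓕 (Sum.inr q) ≤ unramifiedSubgroup (GaloisRep.toLocal q ρ) 1)
    (hfs : ∀ q ∈ D.primes, ∀ x ∈ unramifiedSubgroup (GaloisRep.toLocal q ρ) 1,
      D'.fs q x = u q • D.fs q x)
    {κ : Finset (HeightOneSpectrum (𝓞 K)) → galoisCohomology ρ 1} (hκ : D.IsKolyvaginSystem 𝓕 κ) :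
    D'.IsKolyvaginSystem 𝓕 (fun d => (∏ q ∈ d, u q) • κ d) := by
  have hlev : ∀ d, D'.IsLevel d ↔ D.IsLevel d := fun d => by
    simp only [KolyvaginDatum.IsLevel, hP]
  have hat : ∀ d, D'.atLevel 𝓕 d = D.atLevel 𝓕 d := fun d => by
    simp only [KolyvaginDatum.atLevel, hT]
  refine ⟨fun d hd => ?_, fun d hd => ?_, fun d hd q hq hqd => ?_⟩
  · rw [hκ.eq_zero_of_not_isLevel d (fun h => hd ((hlev d).mpr h)), smul_zero]
  · rw [hat]
    exact AddSubgroup.zsmul_mem _ (hκ.mem_selmerGroup d ((hlev d).mp hd)) _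
  · rw [hP] at hq
    have hd' : D.IsLevel d := (hlev d).mp hd
    have hrel := hκ.fs_rel d hd' q hq hqd
    -- `loc_𝔮 κ_d ∈ 𝓕(d)_𝔮 = 𝓕_𝔮 ≤ H¹_ur`
    have hmem : galoisCohomology.localization ρ (Sum.inr q) 1 (κ d) ∈
        unramifiedSubgroup (GaloisRep.toLocal q ρ) 1 := by
      have h := (SelmerStructure.mem_selmerGroup_iff _ _).1 (hκ.mem_selmerGroup d hd') (Sum.inr q)
      rw [CoreRankZero.Level.atLevel_inr_of_not_mem D 𝓕 hqd] at h
      exact h𝓕 q hq h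
    have hloc : D'.fsLocalization q (κ d) = u q • D.fsLocalization q (κ d) := hfs q hq _ hmem
    rw [Finset.prod_insert hqd, map_zsmul, map_zsmul, hrel, hloc, smul_smul, mul_comm]

/-- **The rescaling is an isomorphism `KS(D, 𝓕) ≃+ KS(D', 𝓕)`** (n1011-p13's
`exists_kolyvaginSystems_addEquiv_rescale` with the relation asked only on `H¹_ur`, under
`𝓕_𝔮 ≤ H¹_ur` at `𝒫`): given `w_𝔮` with `(w_𝔮 u_𝔮) · x = x` on `H¹(K, T)` and on the singular
quotients, `κ ↦ (d ↦ (∏_{𝔮∈d} u_𝔮) κ_d)` is an additive equivalence with inverse the rescaling by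
the `w_𝔮`. [cite: Sakamoto2024, Def. 4.1 and Rem. 4.3 (p. 926)] [cite: Rubin2011, Def. 2.2.1 (p. 18)] -/
theorem exists_kolyvaginSystems_addEquiv_rescale_of_le_unramified {D D' : KolyvaginDatum ρ}
    (u w : HeightOneSpectrum (𝓞 K) → ℤ) (hP : D'.primes = D.primes)
    (hT : D'.transverse = D.transverse) {𝓕 : SelmerStructure ρ}
    (h𝓕 : ∀ q ∈ D.primes, 𝓕 (Sum.inr q) ≤ unramifiedSubgroup (GaloisRep.toLocal q ρ) 1)
    (hfs : ∀ q ∈ D.primes, ∀ x ∈ unramifiedSubgroup (GaloisRep.toLocal q ρ) 1,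
      D'.fs q x = u q • D.fs q x)
    (huw : ∀ q (x : galoisCohomology ρ 1), (w q * u q) • x = x)
    (huw' : ∀ q (y : SingularQuotient (GaloisRep.toLocal q ρ)), (w q * u q) • y = y) :
    ∃ e : D.kolyvaginSystems 𝓕 ≃+ D'.kolyvaginSystems 𝓕,
      ∀ (κ : D.kolyvaginSystems 𝓕) (d : Finset (HeightOneSpectrum (𝓞 K))),
        (e κ).1 d = (∏ q ∈ d, u q) • κ.1 d := by
  -- the inverse relation `φ^{fs} = w · φ'^{fs}` on `H¹_ur`, `𝔮 ∈ 𝒫`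
  have hfs' : ∀ q ∈ D'.primes, ∀ x ∈ unramifiedSubgroup (GaloisRep.toLocal q ρ) 1,
      D.fs q x = w q • D'.fs q x := by
    intro q hq x hx
    rw [hP] at hq
    rw [hfs q hq x hx, smul_smul, huw']
  have h𝓕' : ∀ q ∈ D'.primes, 𝓕 (Sum.inr q) ≤ unramifiedSubgroup (GaloisRep.toLocal q ρ) 1 := by
    rw [hP]; exact h𝓕
  have hwu : ∀ (d : Finset (HeightOneSpectrum (𝓞 K))) (x : galoisCohomology ρ 1),
      (∏ q ∈ d, w q) • (∏ q ∈ d, u q) • x = x := fun d x => by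
    rw [smul_smul, ← Finset.prod_mul_distrib]
    exact finset_prod_smul_eq_self (fun q => w q * u q) huw d x
  have huw2 : ∀ (d : Finset (HeightOneSpectrum (𝓞 K))) (x : galoisCohomology ρ 1),
      (∏ q ∈ d, u q) • (∏ q ∈ d, w q) • x = x := fun d x => by
    rw [smul_smul, ← Finset.prod_mul_distrib]
    refine finset_prod_smul_eq_self (fun q => u q * w q) (fun q y => ?_) d x
    rw [mul_comm]
    exact huw q y
  refine ⟨{ toFun := fun κ => ⟨fun d => (∏ q ∈ d, u q) • κ.1 d,
              (KolyvaginDatum.mem_kolyvaginSystems_iff _ _ _).mpr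
                (isKolyvaginSystem_rescale_of_le_unramified u hP hT h𝓕 hfs
                  ((KolyvaginDatum.mem_kolyvaginSystems_iff _ _ _).mp κ.2))⟩
            invFun := fun κ' => ⟨fun d => (∏ q ∈ d, w q) • κ'.1 d,
              (KolyvaginDatum.mem_kolyvaginSystems_iff _ _ _).mpr
                (isKolyvaginSystem_rescale_of_le_unramified w hP.symm hT.symm h𝓕' hfs'
                  ((KolyvaginDatum.mem_kolyvaginSystems_iff _ _ _).mp κ'.2))⟩
            left_inv := fun κ => Subtype.ext (funext fun d => hwu d _)
            right_inv := fun κ' => Subtype.ext (funext fun d => huw2 d _)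
            map_add' := fun κ₁ κ₂ => Subtype.ext (funext fun d => ?_) }, fun κ d => rfl⟩
  change (∏ q ∈ d, u q) • (κ₁.1 d + κ₂.1 d) = (∏ q ∈ d, u q) • κ₁.1 d + (∏ q ∈ d, u q) • κ₂.1 d
  rw [smul_add]

/-- **END — "the choice of `φ^{fs}` does not matter": two ADMISSIBLE Kolyvagin data with the same
primes and transverse conditions, for an `N`-torsion `T` with `H¹_ur(K_𝔮, T)` free of rank one over
`ℤ/N` at every `𝔮 ∈ 𝒫`, have isomorphic groups of Kolyvagin systems** `KS(D, 𝓕) ≃+ KS(D', 𝓕)`,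
`κ_d ↦ (∏_{𝔮∈d} u_𝔮) κ_d` with `w_𝔮 u_𝔮 ≡ 1 (mod N)`, for every Selmer structure `𝓕` that is
unramified-or-finer at `𝒫` ([MR04] Lemma 1.2.3 ⇒ the data differ by units of `R`; Sakamoto Rem. 4.3);
for `𝓕 = 𝓕_can(E[p^{k+1}])` and `𝒫 ⊆ {good v ∤ p}` the hypothesis `h𝓕` holds with equality
(`propagatedSelmerStructure_inr_eq_unramifiedSubgroup`, Rubin §3.1 "`𝓕_can` is unramified at `v ∤ p`").
[cite: MazurRubin2004, Lemma 1.2.3 (p. 10–11)] [cite: Sakamoto2024, Def. 4.1 and Rem. 4.3 (p. 926)]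
[cite: Rubin2011, Exercise 1.9.7 (p. 15)] -/
theorem exists_kolyvaginSystems_addEquiv_of_isAdmissible {D D' : KolyvaginDatum ρ} {N : ℕ} [NeZero N]
    (hM : ∀ m : M, N • m = 0) (hD : D.IsAdmissible) (hD' : D'.IsAdmissible)
    (hP : D'.primes = D.primes) (hT : D'.transverse = D.transverse)
    (hfree : ∀ q ∈ D.primes,
      KolyvaginSystem.IsFreeRankOneZMod (unramifiedSubgroup (GaloisRep.toLocal q ρ) 1) N)
    (𝓕 : SelmerStructure ρ)
    (h𝓕 : ∀ q ∈ D.primes, 𝓕 (Sum.inr q) ≤ unramifiedSubgroup (GaloisRep.toLocal q ρ) 1) :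
    ∃ (u w : HeightOneSpectrum (𝓞 K) → ℤ) (e : D.kolyvaginSystems 𝓕 ≃+ D'.kolyvaginSystems 𝓕),
      (∀ q, ((w q * u q : ℤ) : ZMod N) = 1) ∧
        ∀ (κ : D.kolyvaginSystems 𝓕) (d : Finset (HeightOneSpectrum (𝓞 K))),
          (e κ).1 d = (∏ q ∈ d, u q) • κ.1 d := by
  obtain ⟨u, w, hwu, hfs⟩ := exists_rescaling_of_isAdmissible hD hD' hP hfree
  have huw : ∀ q (x : galoisCohomology ρ 1), (w q * u q) • x = x := fun q x =>
    zsmul_eq_self_of_intCast_eq_one (hwu q) (galoisCohomology.nsmul_eq_zero_of_forall ρ hM x)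
  have huw' : ∀ q (y : SingularQuotient (GaloisRep.toLocal q ρ)), (w q * u q) • y = y := by
    intro q y
    induction y using QuotientAddGroup.induction_on with
    | H c =>
      refine zsmul_eq_self_of_intCast_eq_one (hwu q) ?_
      rw [← QuotientAddGroup.mk_nsmul,
        galoisCohomology.nsmul_eq_zero_of_forall (GaloisRep.toLocal q ρ) hM c,
        QuotientAddGroup.mk_zero]
  obtain ⟨e, he⟩ :=
    exists_kolyvaginSystems_addEquiv_rescale_of_le_unramified u w hP hT h𝓕 hfs huw huw'
  exact ⟨u, w, e, hwu, he⟩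

end Rescale

/-! ### §4 Over `ℚ` at Sakamoto's primes: canonical data for two generator choices -/

section Canonical

variable {M : Type} [AddCommGroup M] [TopologicalSpace M] [DiscreteTopology M]
variable (ρ : DiscreteGaloisModule ℚ M) (p n : ℕ) [Fact p.Prime] [NeZero n]
  [Module (ZMod (p ^ n)) M] [Module.Free (ZMod (p ^ n)) M] [Module.Finite (ZMod (p ^ n)) M]

/-- **`KS(D, 𝓕) ≃+ KS(D', 𝓕)` for two CANONICAL data over `ℚ`** (generator choices `η, η'`; the same
primes inside Sakamoto's `τ`-class, the same transverse conditions; `T` a free finite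
`ℤ/p^n`-module with (H.2) `T/(τ − 1)T ≃ ℤ/p^n` and `τ` fixing `μ_{p^n}`), for every Selmer structure
unramified-or-finer at `𝒫`: admissibility is `isAdmissible_of_hasCanonicalComparison_of_subset_primePow`
([MR04] Lemma 1.2.3 / Rubin Ex. 1.9.7 in the kernel), local freeness is
`isFreeRankOneZMod_unramifiedSubgroup_of_mem_frobeniusClassPrimes`, and §3 does the rest.
[cite: MazurRubin2004, Lemma 1.2.3 (p. 10–11)] [cite: Sakamoto2024, §4, Def. 4.1, Rem. 4.3 (pp. 925–926)] -/
theorem exists_kolyvaginSystems_addEquiv_of_hasCanonicalComparison_primePow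
    (S : Set (HeightOneSpectrum (𝓞 ℚ))) {τ : absoluteGaloisGroup ℚ}
    (hτq : Nonempty (cokerSubOne ρ τ ≃+ ZMod (p ^ n))) (hτμ : τ ∈ rootsOfUnityFixer ℚ (p ^ n))
    {D D' : KolyvaginDatum ρ} (hP : D.primes ⊆ frobeniusClassPrimes ρ S τ (p ^ n))
    (hP' : D'.primes = D.primes) (hT : D'.transverse = D.transverse)
    {η η' : (q : HeightOneSpectrum (𝓞 ℚ)) → (ZMod (Ideal.absNorm q.asIdeal))ˣ}
    (hD : D.HasCanonicalComparison (p ^ n) η) (hD' : D'.HasCanonicalComparison (p ^ n) η')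
    (𝓕 : SelmerStructure ρ)
    (h𝓕 : ∀ q ∈ D.primes, 𝓕 (Sum.inr q) ≤ unramifiedSubgroup (GaloisRep.toLocal q ρ) 1) :
    ∃ (u w : HeightOneSpectrum (𝓞 ℚ) → ℤ) (e : D.kolyvaginSystems 𝓕 ≃+ D'.kolyvaginSystems 𝓕),
      (∀ q, ((w q * u q : ℤ) : ZMod (p ^ n)) = 1) ∧
        ∀ (κ : D.kolyvaginSystems 𝓕) (d : Finset (HeightOneSpectrum (𝓞 ℚ))),
          (e κ).1 d = (∏ q ∈ d, u q) • κ.1 d := by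
  haveI : NeZero (p ^ n) := ⟨pow_ne_zero _ (Fact.out : p.Prime).ne_zero⟩
  haveI : Finite M := Module.finite_of_finite (ZMod (p ^ n))
  have hM : ∀ m : M, (p ^ n) • m = 0 := fun m => by
    rw [← Nat.cast_smul_eq_nsmul (ZMod (p ^ n)), ZMod.natCast_self, zero_smul]
  have hPD' : D'.primes ⊆ frobeniusClassPrimes ρ S τ (p ^ n) := by rw [hP']; exact hP
  have hadm := isAdmissible_of_hasCanonicalComparison_of_subset_primePow ρ p n S hτq hτμ hP hD
  have hadm' := isAdmissible_of_hasCanonicalComparison_of_subset_primePow ρ p n S hτq hτμ hPD' hD'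
  have hfree : ∀ q ∈ D.primes, KolyvaginSystem.IsFreeRankOneZMod
      (unramifiedSubgroup (GaloisRep.toLocal q ρ) 1) (p ^ n) := fun q hq =>
    isFreeRankOneZMod_unramifiedSubgroup_of_mem_frobeniusClassPrimes ρ hτq (hP hq)
  exact exists_kolyvaginSystems_addEquiv_of_isAdmissible hM hadm hadm' hP' hT hfree 𝓕 h𝓕

end Canonical

end Summit.BirchSwinnertonDyer.Rank1Residual.GaloisImage.FSComp

end
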